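import Summits.QuantumFields.YangMills.Theorems.StaticSourceWitnessRungLatticeResponse
import Literature.Probability.LatticeModels.ThermodynamicLimit
import Literature.Probability.Distributions.GaussianWickTheorem

/-!
# BC5 rung (T3 witness) for `FiniteRankMirror.X₁ = FiniteRankMirrorFloor`, banked 1/3:
# the mirror functional of the lattice Maxwell field and its Wick expansion

Tribunal-w seat `ym-mirror-bc5w-1` (g4, 2026-08-28), `--supports stmt-QuantumFields-25679` (route
`route-QuantumFields-FiniteRankMirror`).  This is the importable, citable-by-name port of §1–§4 of the crux
work file `Cruxes/FiniteRankMirrorFloor/Lines/rung_lattice.lean` (g3, commit 67076f913b1c, judged T3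
PRESENT in `j-t3-note-g41.md`), re-based on the lattice-Maxwell objects ALREADY banked by the sibling rung
`Theorems/StaticSourceWitnessRung*.lean` (namespace `…Theorems.StaticSourceWitness.Rung`: `Cfg`,
`μM = curvatureGaussianField 4 1`, `plaqAt`, `densA`, `P12`, and the Gaussian facts `isGaussianProcess_eval`,
`memLp_eval`, `integral_eval`) instead of duplicating them.

**The model and the dictionary to the crux** (each crux symbol ↦ its abelian-Gaussian counterpart):
`torusE G r β L F` ↦ `∫ F dμM` (the abelian lattice gauge theory of `ℤ⁴` at Gaussian coupling; the volume
`L` survives only as the probe cut-off `box 4 L`, verbatim the crux's `box 4 L` of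
`Literature.Probability.LatticeModels`); `dens G r y V` ↦ `densA y ω = ∑_{q at y} Y_q²`;
`cfgReflect` (Osterwalder–Seiler time reflection) ↦ `cfgReflA` (§1); the mirror functional
`torusE((F∘Θ)·F) − torusE(F)²` with `F = ∑_{y ∈ box 4 L} v(a y)·dens y` ↦ `MF a v L` (§1).

**Proved here (no `sorry`).**  `E[probe∘Θ] = E[probe]` (`integral_probe_cfgReflA`), so
`MF = Cov(probe∘Θ, probe)` (`MF_eq_cov`); Isserlis/Wick for squares `Cov(Y_p², Y_q²) = 2·curvatureTwoPoint p q²`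
(`cov_sq_sq`, from the tree's `GaussianWick.integral_prod_four`); the exact expansion
`MF a v L = ∑_{y,y' ∈ box 4 L} mterm a v y y'` (`MF_eq`) with nonnegative terms for `v ≥ 0` (`MF_nonneg`).
Files 2/3 (`FiniteRankMirrorRungFloor`) and 3/3 (`FiniteRankMirrorRungWitness`) prove the hyperscaling floor
and X₁'s block with `J = 1`, `p = 0`.

NOTHING HERE PROVES the Yang–Mills mass gap, `BalabanLadder.NT`, `FiniteRankMirrorFloor` itself (a
statement about compact SIMPLE `G` and Wilson's measure) or any item of the route: it is the free abelian
model's instance of X₁'s block, a T3 witness of weakness only.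
-/

open MeasureTheory ProbabilityTheory Filter
open scoped Real NNReal ENNReal Topology

noncomputable section

namespace Summit.QuantumFields.YangMills.Theorems.FiniteRankMirror.Rung

open Literature.Probability.LatticeModels Literature.MathematicalPhysics.QuantumLattice
  Literature.MathematicalPhysics.QuantumFieldTheory Literature.Probability.Distributions
open Summit.QuantumFields.YangMills.Theorems.StaticSourceWitness.Rung
  (Cfg μM Plane P12 plaqAt densA isProbabilityMeasure_μM isGaussianProcess_eval memLp_eval integral_eval)

/-! ## §1 The probe with the crux's cut-off `box 4 L`, the reflection `Θ`, the mirror functional -/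

/-- The probe `∑_{y ∈ box 4 L} v(a y) · densA y` at spacing `a` with the crux's volume cut-off `box 4 L`
(↦ the crux's `fun V => ∑ y ∈ box 4 L, v j (a β • siteToE y) * dens G r y V`). [this route] -/
def probe (a : ℝ) (v : EuclideanSpace ℝ (Fin 4) → ℝ) (L : ℕ) (ω : Cfg) : ℝ :=
  ∑ y ∈ box 4 L, v (a • siteToE y) * densA y ω

/-- Site reflection in time `ϑ(y₀, y⃗) = (−y₀, y⃗)` (the tree's `siteReflect`). [folklore] -/
def tref (y : Site 4) : Site 4 := Function.update y 0 (-y 0)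

/-- `(ϑy)₀ = −y₀`. [folklore] -/
@[simp] theorem tref_apply_zero (y : Site 4) : tref y 0 = -y 0 := by simp [tref]

/-- `(ϑy)_k = y_k` for `k ≠ 0`. [folklore] -/
theorem tref_apply_of_ne (y : Site 4) {k : Fin 4} (hk : k ≠ 0) : tref y k = y k := by
  simp [tref, hk]

/-- The plaquette read by the reflected configuration at `q = (y; i<j)`: `(ϑy; i, j)` if spacelike,
`(ϑy − e₀; 0, j)` if timelike (the plaquettes of the tree's `reflectEdge`/`cfgReflect`). [folklore] -/
def reflPlaq (q : ZdPlaquette 4) : ZdPlaquette 4 :=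
  (if q.2.1.1 = 0 then tref q.1 - Pi.single 0 1 else tref q.1, q.2)

/-- Orientation sign of the pulled-back 2-form: `F_{0j} ↦ −F_{0j}∘ϑ`, `F_{ij} ↦ F_{ij}∘ϑ`. [folklore] -/
def reflSign (q : ZdPlaquette 4) : ℝ := if q.2.1.1 = 0 then -1 else 1

/-- The orientation sign squares to `1`. [folklore] -/
theorem reflSign_sq (q : ZdPlaquette 4) : reflSign q ^ 2 = 1 := by
  unfold reflSign; split_ifs <;> norm_num

/-- **The reflection `Θ` on abelian curvature configurations** (↦ the crux's `cfgReflect`). [folklore] -/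
def cfgReflA (ω : Cfg) : Cfg := fun q c => reflSign q * ω (reflPlaq q) c

/-- The reflection reads the spacelike `(1,2)` plaquette at `y` at `ϑy`. [folklore] -/
theorem reflPlaq_P12 (y : Site 4) : reflPlaq (y, P12) = (tref y, P12) := by
  simp [reflPlaq, P12]

/-- The reflected density `∑_{q at y} Y_{Θq}²`. -/
def densR (y : Site 4) (ω : Cfg) : ℝ := ∑ q ∈ plaqAt y, ω (reflPlaq q) 0 ^ 2

/-- The reflected probe. -/
def probeR (a : ℝ) (v : EuclideanSpace ℝ (Fin 4) → ℝ) (L : ℕ) (ω : Cfg) : ℝ :=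
  ∑ y ∈ box 4 L, v (a • siteToE y) * densR y ω

/-- `densA y (Θω) = densR y ω` (the signs square away). [folklore] -/
theorem densA_cfgReflA (y : Site 4) (ω : Cfg) : densA y (cfgReflA ω) = densR y ω := by
  simp only [densA, densR, cfgReflA]
  refine Finset.sum_congr rfl fun q _ => ?_
  rw [mul_pow, reflSign_sq, one_mul]

/-- `probe (Θω) = probeR ω`. [folklore] -/
theorem probe_cfgReflA (a : ℝ) (v : EuclideanSpace ℝ (Fin 4) → ℝ) (L : ℕ) (ω : Cfg) :
    probe a v L (cfgReflA ω) = probeR a v L ω := by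
  simp only [probe, probeR, densA_cfgReflA]

/-- **The mirror functional of the crux in this model**: `torusE((F∘Θ)·F) − torusE(F)²` ↦
`∫ probe(Θω)·probe(ω) dμM − (∫ probe dμM)²`. [this route] -/
def MF (a : ℝ) (v : EuclideanSpace ℝ (Fin 4) → ℝ) (L : ℕ) : ℝ :=
  (∫ ω, probe a v L (cfgReflA ω) * probe a v L ω ∂μM) - (∫ ω, probe a v L ω ∂μM) ^ 2

/-- `MF` written out with the crux's block shape, symbol for symbol (`torusE ↦ ∫·dμM`, `dens ↦ densA`,
`cfgReflect ↦ cfgReflA`). [this route] -/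
theorem MF_def (a : ℝ) (v : EuclideanSpace ℝ (Fin 4) → ℝ) (L : ℕ) :
    MF a v L = (∫ ω, (∑ y ∈ box 4 L, v (a • siteToE y) * densA y (cfgReflA ω)) *
        ∑ y ∈ box 4 L, v (a • siteToE y) * densA y ω ∂μM) -
      (∫ ω, ∑ y ∈ box 4 L, v (a • siteToE y) * densA y ω ∂μM) ^ 2 := rfl

/-- the `(y, y')` term of the expanded mirror functional -/
def mterm (a : ℝ) (v : EuclideanSpace ℝ (Fin 4) → ℝ) (y y' : Site 4) : ℝ :=
  v (a • siteToE y) * v (a • siteToE y') *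
    ∑ q ∈ plaqAt y, ∑ q' ∈ plaqAt y', 2 * curvatureTwoPoint (reflPlaq q) q' ^ 2

/-! ## §2 Gaussian moments of the curvature field: `E[Y_pY_q]`, `E[Y_q²] = 1/2`, Isserlis for squares -/

/-- Each coordinate `ω ↦ Y_q(ω)` is measurable. [folklore] -/
theorem measurable_eval (q : ZdPlaquette 4) : Measurable fun ω : Cfg => ω q 0 :=
  (measurable_pi_apply 0).comp (measurable_pi_apply q)

/-- Plaquette curvatures are centred (pair-indexed form for the Wick theorem). [folklore] -/
theorem integral_eval' (t : ZdPlaquette 4 × Fin 1) : ∫ ω : Cfg, ω t.1 t.2 ∂μM = 0 :=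
  integral_eval_curvatureGaussianField (by norm_num : 3 ≤ 4) 1 t.1 t.2

/-- `E[Y_p Y_q] = curvatureTwoPoint p q`. [folklore] -/
theorem integral_mul_eval (p q : ZdPlaquette 4) :
    ∫ ω, ω p 0 * ω q 0 ∂μM = curvatureTwoPoint p q := by
  haveI := isProbabilityMeasure_μM
  have h := covariance_eval_curvatureGaussianField (by norm_num : 3 ≤ 4) 1 p q 0 0
  rw [if_pos rfl, covariance_eq_sub (memLp_eval p) (memLp_eval q), integral_eval, integral_eval,
    mul_zero, sub_zero] at h
  simpa only [Pi.mul_apply] using h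

/-- `E[Y_q²] = 1/2` for EVERY plaquette (equipartition; `curvatureTwoPoint_self`). [folklore] -/
theorem integral_sq_eval (q : ZdPlaquette 4) : ∫ ω, ω q 0 ^ 2 ∂μM = 1 / 2 := by
  have h := integral_mul_eval q q
  rw [curvatureTwoPoint_self (by norm_num : 3 ≤ 4)] at h
  have e : ∫ ω, ω q 0 ^ 2 ∂μM = ∫ ω, ω q 0 * ω q 0 ∂μM :=
    integral_congr_ae (ae_of_all _ fun ω => by simp [sq])
  rw [e, h]
  norm_num

/-- `Y_q⁴` is integrable (Gaussian moments). [folklore] -/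
theorem integrable_pow_four (q : ZdPlaquette 4) : Integrable (fun ω : Cfg => ω q 0 ^ 4) μM := by
  have h := GaussianWick.integrable_pow_mul_prod isGaussianProcess_eval (q, (0 : Fin 1)) 4
    (∅ : Finset (Fin 1)) (fun _ => (q, (0 : Fin 1)))
  simpa using h

/-- `Y_q²` is square integrable. [folklore] -/
theorem memLp_two_sq (q : ZdPlaquette 4) : MemLp (fun ω : Cfg => ω q 0 ^ 2) 2 μM := by
  haveI := isProbabilityMeasure_μM
  refine (memLp_two_iff_integrable_sq ((measurable_eval q).pow_const 2).aestronglyMeasurable).2 ?_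
  have e : (fun ω : Cfg => (ω q 0 ^ 2) ^ 2) = fun ω => ω q 0 ^ 4 := by
    funext ω; ring
  rw [e]
  exact integrable_pow_four q

/-- **Isserlis / Wick for two squares**: `E[Y_p² Y_q²] = E[Y_p²]E[Y_q²] + 2 E[Y_pY_q]²`. [folklore] -/
theorem integral_sq_mul_sq (p q : ZdPlaquette 4) :
    ∫ ω, ω p 0 ^ 2 * ω q 0 ^ 2 ∂μM = 1 / 2 * (1 / 2) + 2 * curvatureTwoPoint p q ^ 2 := by
  have h4 := GaussianWick.integral_prod_four isGaussianProcess_eval integral_eval'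
    ![((p, 0) : ZdPlaquette 4 × Fin 1), (p, 0), (q, 0), (q, 0)]
  have e0 : (![((p, 0) : ZdPlaquette 4 × Fin 1), (p, 0), (q, 0), (q, 0)]) 0 = (p, 0) := rfl
  have e1 : (![((p, 0) : ZdPlaquette 4 × Fin 1), (p, 0), (q, 0), (q, 0)]) 1 = (p, 0) := rfl
  have e2 : (![((p, 0) : ZdPlaquette 4 × Fin 1), (p, 0), (q, 0), (q, 0)]) 2 = (q, 0) := rfl
  have e3 : (![((p, 0) : ZdPlaquette 4 × Fin 1), (p, 0), (q, 0), (q, 0)]) 3 = (q, 0) := rfl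
  simp only [e0, e1, e2, e3] at h4
  rw [integral_mul_eval p p, integral_mul_eval q q, integral_mul_eval p q,
    curvatureTwoPoint_self (by norm_num : 3 ≤ 4) p, curvatureTwoPoint_self (by norm_num : 3 ≤ 4) q] at h4
  have hl : ∀ ω : Cfg, ω p 0 ^ 2 * ω q 0 ^ 2 = ω p 0 * ω p 0 * ω q 0 * ω q 0 := fun ω => by ring
  simp_rw [hl, h4]
  push_cast
  ring

/-- **`Cov(Y_p², Y_q²) = 2·curvatureTwoPoint p q²`** — the Wick step of the dictionary, a theorem. [folklore] -/
theorem cov_sq_sq (p q : ZdPlaquette 4) :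
    cov[fun ω : Cfg => ω p 0 ^ 2, fun ω : Cfg => ω q 0 ^ 2; μM] = 2 * curvatureTwoPoint p q ^ 2 := by
  haveI := isProbabilityMeasure_μM
  rw [covariance_eq_sub (memLp_two_sq p) (memLp_two_sq q)]
  simp only [Pi.mul_apply]
  rw [integral_sq_mul_sq, integral_sq_eval, integral_sq_eval]
  ring

/-! ## §3 Expectations of the probe and of the reflected probe coincide -/

/-- The density `densA y` is square integrable. [folklore] -/
theorem memLp_densA (y : Site 4) : MemLp (densA y) 2 μM := by
  show MemLp (fun ω : Cfg => ∑ q ∈ plaqAt y, ω q 0 ^ 2) 2 μM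
  exact memLp_finsetSum _ fun q _ => memLp_two_sq q

/-- The reflected density `densR y` is square integrable. [folklore] -/
theorem memLp_densR (y : Site 4) : MemLp (densR y) 2 μM := by
  show MemLp (fun ω : Cfg => ∑ q ∈ plaqAt y, ω (reflPlaq q) 0 ^ 2) 2 μM
  exact memLp_finsetSum _ fun q _ => memLp_two_sq (reflPlaq q)

/-- The probe is square integrable. [folklore] -/
theorem memLp_probe (a : ℝ) (v : EuclideanSpace ℝ (Fin 4) → ℝ) (L : ℕ) : MemLp (probe a v L) 2 μM := by
  show MemLp (fun ω : Cfg => ∑ y ∈ box 4 L, v (a • siteToE y) * densA y ω) 2 μM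
  exact memLp_finsetSum _ fun y _ => (memLp_densA y).const_mul _

/-- The reflected probe is square integrable. [folklore] -/
theorem memLp_probeR (a : ℝ) (v : EuclideanSpace ℝ (Fin 4) → ℝ) (L : ℕ) :
    MemLp (probeR a v L) 2 μM := by
  show MemLp (fun ω : Cfg => ∑ y ∈ box 4 L, v (a • siteToE y) * densR y ω) 2 μM
  exact memLp_finsetSum _ fun y _ => (memLp_densR y).const_mul _

/-- `E[densA y] = ∑_{q at y} 1/2`. [folklore] -/
theorem integral_densA (y : Site 4) : ∫ ω, densA y ω ∂μM = ∑ _q ∈ plaqAt y, (1 / 2 : ℝ) := by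
  haveI := isProbabilityMeasure_μM
  simp only [densA]
  rw [integral_finsetSum _ fun q _ => (memLp_two_sq q).integrable one_le_two]
  exact Finset.sum_congr rfl fun q _ => integral_sq_eval q

/-- `E[densR y] = ∑_{q at y} 1/2`. [folklore] -/
theorem integral_densR (y : Site 4) : ∫ ω, densR y ω ∂μM = ∑ _q ∈ plaqAt y, (1 / 2 : ℝ) := by
  haveI := isProbabilityMeasure_μM
  simp only [densR]
  rw [integral_finsetSum _ fun q _ => (memLp_two_sq (reflPlaq q)).integrable one_le_two]
  exact Finset.sum_congr rfl fun q _ => integral_sq_eval (reflPlaq q)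

/-- `E[probe]` in closed form. [folklore] -/
theorem integral_probe (a : ℝ) (v : EuclideanSpace ℝ (Fin 4) → ℝ) (L : ℕ) :
    ∫ ω, probe a v L ω ∂μM = ∑ y ∈ box 4 L, v (a • siteToE y) * ∑ _q ∈ plaqAt y, (1 / 2 : ℝ) := by
  haveI := isProbabilityMeasure_μM
  simp only [probe]
  rw [integral_finsetSum _ fun y _ => ((memLp_densA y).integrable one_le_two).const_mul _]
  refine Finset.sum_congr rfl fun y _ => ?_
  rw [integral_const_mul, integral_densA]

/-- `E[probeR]` in closed form. [folklore] -/
theorem integral_probeR (a : ℝ) (v : EuclideanSpace ℝ (Fin 4) → ℝ) (L : ℕ) :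
    ∫ ω, probeR a v L ω ∂μM = ∑ y ∈ box 4 L, v (a • siteToE y) * ∑ _q ∈ plaqAt y, (1 / 2 : ℝ) := by
  haveI := isProbabilityMeasure_μM
  simp only [probeR]
  rw [integral_finsetSum _ fun y _ => ((memLp_densR y).integrable one_le_two).const_mul _]
  refine Finset.sum_congr rfl fun y _ => ?_
  rw [integral_const_mul, integral_densR]

/-- `E[probeR] = E[probe]`. [folklore] -/
theorem integral_probeR_eq (a : ℝ) (v : EuclideanSpace ℝ (Fin 4) → ℝ) (L : ℕ) :
    ∫ ω, probeR a v L ω ∂μM = ∫ ω, probe a v L ω ∂μM := by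
  rw [integral_probeR, integral_probe]

/-- **Reflection invariance of the probe's mean**: `E[probe ∘ Θ] = E[probe]` (every plaquette has the same
variance), so the crux's `− torusE(F)²` IS the covariance subtraction in this model. [this route] -/
theorem integral_probe_cfgReflA (a : ℝ) (v : EuclideanSpace ℝ (Fin 4) → ℝ) (L : ℕ) :
    ∫ ω, probe a v L (cfgReflA ω) ∂μM = ∫ ω, probe a v L ω ∂μM := by
  simp_rw [probe_cfgReflA]
  exact integral_probeR_eq a v L

/-! ## §4 The mirror functional is a covariance; its exact Wick expansion -/

/-- `MF a v L = Cov(probeR, probe)`: the crux's mean subtraction is the covariance subtraction here. [this route] -/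
theorem MF_eq_cov (a : ℝ) (v : EuclideanSpace ℝ (Fin 4) → ℝ) (L : ℕ) :
    MF a v L = cov[probeR a v L, probe a v L; μM] := by
  haveI := isProbabilityMeasure_μM
  rw [covariance_eq_sub (memLp_probeR a v L) (memLp_probe a v L), MF]
  simp only [Pi.mul_apply, probe_cfgReflA]
  rw [integral_probeR_eq a v L, sq]

/-- Bilinear expansion of `Cov(probeR, probe)` into the plaquette-pair terms `mterm`. [this route] -/
theorem cov_expand (a : ℝ) (v : EuclideanSpace ℝ (Fin 4) → ℝ) (L : ℕ) :
    cov[probeR a v L, probe a v L; μM] = ∑ y ∈ box 4 L, ∑ y' ∈ box 4 L, mterm a v y y' := by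
  haveI := isProbabilityMeasure_μM
  have h1 : cov[probeR a v L, probe a v L; μM] =
      ∑ y ∈ box 4 L, ∑ y' ∈ box 4 L,
        cov[fun ω => v (a • siteToE y) * densR y ω, fun ω => v (a • siteToE y') * densA y' ω; μM] := by
    show cov[fun ω => ∑ y ∈ box 4 L, v (a • siteToE y) * densR y ω,
      fun ω => ∑ y' ∈ box 4 L, v (a • siteToE y') * densA y' ω; μM] = _
    exact covariance_fun_sum_fun_sum' (fun y _ => (memLp_densR y).const_mul _)
      (fun y' _ => (memLp_densA y').const_mul _)
  rw [h1]
  refine Finset.sum_congr rfl fun y _ => Finset.sum_congr rfl fun y' _ => ?_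
  rw [covariance_const_mul_left, covariance_const_mul_right, ← mul_assoc, mterm]
  congr 1
  show cov[fun ω : Cfg => ∑ q ∈ plaqAt y, ω (reflPlaq q) 0 ^ 2,
    fun ω : Cfg => ∑ q' ∈ plaqAt y', ω q' 0 ^ 2; μM] = _
  rw [covariance_fun_sum_fun_sum' (fun q _ => memLp_two_sq (reflPlaq q)) (fun q' _ => memLp_two_sq q')]
  exact Finset.sum_congr rfl fun q _ => Finset.sum_congr rfl fun q' _ => cov_sq_sq (reflPlaq q) q'

/-- **The Wick expansion of the mirror functional**:
`MF a v L = ∑_{y,y' ∈ box 4 L} v(ay) v(ay') ∑_{q at y} ∑_{q' at y'} 2·curvatureTwoPoint(Θq, q')²`. [this route] -/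
theorem MF_eq (a : ℝ) (v : EuclideanSpace ℝ (Fin 4) → ℝ) (L : ℕ) :
    MF a v L = ∑ y ∈ box 4 L, ∑ y' ∈ box 4 L, mterm a v y y' := by
  rw [MF_eq_cov, cov_expand]

/-- Every term of the expansion is `≥ 0` for a nonnegative probe. [this route] -/
theorem mterm_nonneg {a : ℝ} {v : EuclideanSpace ℝ (Fin 4) → ℝ} (hv : ∀ z, 0 ≤ v z) (y y' : Site 4) :
    0 ≤ mterm a v y y' :=
  mul_nonneg (mul_nonneg (hv _) (hv _))
    (Finset.sum_nonneg fun _ _ => Finset.sum_nonneg fun _ _ => by positivity)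

/-- Mirror positivity of the free model for nonnegative probes (termwise). [this route] -/
theorem MF_nonneg {a : ℝ} {v : EuclideanSpace ℝ (Fin 4) → ℝ} (hv : ∀ z, 0 ≤ v z) (L : ℕ) :
    0 ≤ MF a v L := by
  rw [MF_eq]
  exact Finset.sum_nonneg fun y _ => Finset.sum_nonneg fun y' _ => mterm_nonneg hv y y'

end Summit.QuantumFields.YangMills.Theorems.FiniteRankMirror.Rung

end
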